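import Literature.NumberTheory.Sieve.LevelOfDistribution
import HarnessLib

/-!
# Bombieri–Friedlander–Iwaniec, Theorem 10: primes in progressions to well-factorable moduli

Trunk `AntSieve`, companion to `Literature.NumberTheory.Sieve.LevelOfDistribution` (item C12,
`level_of_distribution`), serving the named fact `Literature.NumberTheory.Sieve.bfi_wellFactorable_level` there.

## Contents

* API for `Literature.NumberTheory.Sieve.IsWellFactorable` (BFI 1986 §1, Definition before Theorem 10 / Maynard 2020,
  Definition 1): the trivial weights, vanishing above the level, and monotonicity of the level
  (`IsWellFactorable.mono`: a well-factorable function of level `D ≥ 1` is well-factorable of every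
  level `D' ≥ D`).
* API for `Literature.NumberTheory.Sieve.PrimesHaveWellFactorableLevel` (all PROVED): monotonicity in the exponent
  (`PrimesHaveWellFactorableLevel.mono`), a Bombieri–Vinogradov level is a well-factorable level
  (`PrimesHaveLevel.primesHaveWellFactorableLevel`, so `BombieriVinogradovStatement` gives every
  `θ < 1/2`), and `bfi_wellFactorable_level` gives every `θ ≤ 4/7`
  (`bfi_wellFactorable_level.primesHaveWellFactorableLevel`).
* `Literature.NumberTheory.Sieve.BombieriFriedlanderIwaniecTheorem10`: the theorem AS PRINTED (Acta Math. 156 (1986), §1,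
  Theorem 10), which is the `ψ`-form: for `a ≠ 0`, `ε > 0`, `Q = x^{4/7−ε}` and `A > 0` there is
  `C = C(ε, a, A)` such that for all large `x` and every well-factorable `λ` of level `Q`,
  `|∑_{(q,a)=1} λ(q) (ψ(x; q, a) − x/φ(q))| ≤ C x/(log x)^A`.
* `Literature.NumberTheory.Sieve.bfi_wellFactorable_level_of_theorem10`: the printed theorem implies the tree's
  `bfi_wellFactorable_level = PrimesHaveWellFactorableLevel (4/7)` (PROVED; the latter quantifies
  over families `λ_x` and asks for `=O[atTop]`, which is exactly the uniformity in `λ` of the print).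
* `Literature.NumberTheory.Sieve.BombieriFriedlanderIwaniecTheorem10Pi`: the `π`-form, as the theorem is restated in
  Maynard, arXiv:2006.07088 (Mem. AMS 2025), p. 3, "Theorem (Bombieri, Friedlander, Iwaniec)", and
  in Lichtman, arXiv:2309.08522, (1.3): the same bound for
  `∑_{q ≤ Q, (q,a)=1} λ(q) (π(x; q, a) − π(x)/φ(q))`, uniformly over `Q ≤ x^{4/7−ε}`.  The passage
  `π`-form ⇒ `ψ`-form (partial summation + the prime number theorem with the de la Vallée Poussin
  error term) is PROVED in `Literature.NumberTheory.Sieve.BombieriFriedlanderIwaniecProofs`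
  (`bfi_wellFactorable_level_of_theorem10Pi`), where also `isWellFactorable_iff_bfi` (the tree's
  `IsWellFactorable` is BFI's printed notion for `Q ≥ 1`) is proved.

## Faithfulness notes (source read: Acta Math. 156 (1986), §1, pp. 205–210, and §17)

* BFI's definition (§1): `λ` is well factorable of level `Q` iff for all `Q₁, Q₂ ≥ 1` with
  `Q₁ Q₂ = Q` there are `λ₁, λ₂` supported in `[1, Q₁]`, `[1, Q₂]` with `|λ₁|, |λ₂| ≤ 1` and
  `λ = λ₁ ⋆ λ₂`.  The tree's `IsWellFactorable Q λ` records in addition `|λ| ≤ 1`, `λ(0) = 0` and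
  `λ(n) = 0` for `n > Q`; for `Q ≥ 1` these follow from BFI's clause with `Q₁ = Q`, `Q₂ = 1`
  (`λ₂` is then supported on `{1}`, so `λ = λ₂(1) λ₁`), hence the two notions agree for `Q ≥ 1`
  and hypotheses `IsWellFactorable …` make our statements at most WEAKER than the print.
* BFI's `ε`-convention (Notations: "any statement including `ε` is … true for all sufficiently small
  positive `ε`") and our `∀ ε > 0` agree for Theorem 10: a larger `ε` only shrinks the level, and
  `IsWellFactorable.mono` moves a weight of level `x^{4/7−ε}` to any level `x^{4/7−ε'}`, `ε' < ε`.
* "`≪` with a constant depending on `ε, a, A`" is rendered as `∃ C x₀, ∀ x ≥ x₀, |…| ≤ C x/(log x)^A`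
  (the weakest reading; on bounded ranges of `x ≥ 2` both sides are trivially comparable).
* Maynard's restatement allows any `a ∈ ℤ`; BFI and Lichtman take `a ≠ 0`. We keep `a ≠ 0` (weaker).
* Proof architecture in the source (§17): Theorem 10 follows from the bilinear Theorems 1
  and 2 (moduli `qr`, `R = x^{−ε} N`, `Q ≤ x^{4/7−4ε} N^{−1}`, for `x^{1/7−ε} < N < x^{3/7+ε}`) and
  Theorem 5* (`N ≥ x^{3/7}`), through the machinery of §15 (Heath-Brown's identity = Lemma 5, the
  fundamental lemma = Lemma 4, Siegel–Walfisz for the pieces, Bombieri–Vinogradov (1.4) for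
  `q ≤ x^{1/2−ε}`); Theorems 1–5* rest on the Deshouillers–Iwaniec bounds for sums of Kloosterman
  sums (Lemma 1) via Linnik's dispersion method.  None of this is in Mathlib; the theorem is
  vendored as a named fact (D-0014).

## References

* E. Bombieri, J. B. Friedlander, H. Iwaniec, *Primes in arithmetic progressions to large moduli*,
  Acta Math. 156 (1986), 203–251: §1, Definition and Theorem 10; §17 (proof of Theorem 10).
* J. Maynard, *Primes in arithmetic progressions to large moduli II: Well-factorable estimates*,
  arXiv:2006.07088 (Mem. AMS 2025), Definition 1 and the Theorem attributed to [BFI1], p. 3.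
* J. D. Lichtman, arXiv:2309.08522, Definition 1.3 and (1.3).
-/

open Filter Asymptotics Finset

namespace Literature.NumberTheory.Sieve

/-! ### API for well-factorable functions -/

section API

variable {D : ℝ} {lam : ℕ → ℝ}

/-- A well-factorable function vanishes at `0` (part of the definition; BFI 1986 §1: the weights
live on `1 ≤ q ≤ Q`). [cite: BombieriFriedlanderIwaniecActa1986, §1 Definition] -/
theorem IsWellFactorable.apply_zero (h : IsWellFactorable D lam) : lam 0 = 0 :=
  h.2.1

/-- A well-factorable function of level `D` vanishes above `D` (part of the definition;
BFI 1986 §1). [cite: BombieriFriedlanderIwaniecActa1986, §1 Definition] -/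
theorem IsWellFactorable.eq_zero_of_lt (h : IsWellFactorable D lam) {n : ℕ} (hn : D < n) :
    lam n = 0 :=
  h.2.2.1 n hn

/-- The factorisation property of a well-factorable function (the definition, BFI 1986 §1 /
Maynard 2020 Def. 1): for `D = D₁ D₂`, `D₁, D₂ ≥ 1`, `λ = α ⋆ β` with `1`-bounded `α`, `β` supported
below `D₁`, `D₂`. [cite: BombieriFriedlanderIwaniecActa1986, §1 Definition] -/
theorem IsWellFactorable.exists_eq_mul (h : IsWellFactorable D lam) {D₁ D₂ : ℝ} (hD₁ : 1 ≤ D₁)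
    (hD₂ : 1 ≤ D₂) (hD : D₁ * D₂ = D) :
    ∃ α β : ArithmeticFunction ℝ,
      (∀ n, |α n| ≤ 1) ∧ (∀ n, |β n| ≤ 1) ∧
      (∀ n : ℕ, D₁ < n → α n = 0) ∧ (∀ n : ℕ, D₂ < n → β n = 0) ∧
      ∀ n, lam n = (α * β) n :=
  h.2.2.2 D₁ D₂ hD₁ hD₂ hD

/-- The zero function is well-factorable of every level (`0 = 0 ⋆ 0`). [folklore] -/
theorem isWellFactorable_zero (D : ℝ) : IsWellFactorable D (fun _ => 0) := by
  refine ⟨fun n => by simp, rfl, fun n _ => rfl, fun D₁ D₂ _ _ _ => ⟨0, 0, ?_, ?_, ?_, ?_, ?_⟩⟩ <;>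
    simp

/-- The Dirac weight `δ₁` (`λ(1) = 1`, `λ(n) = 0` otherwise) is well-factorable of every level
`D ≥ 1` (`δ₁ = δ₁ ⋆ δ₁`; Mathlib: `1 : ArithmeticFunction ℝ`). Non-vacuity of the notion. [folklore] -/
theorem isWellFactorable_one {D : ℝ} (hD : 1 ≤ D) :
    IsWellFactorable D (fun n => ((1 : ArithmeticFunction ℝ) n)) := by
  refine ⟨fun n => ?_, by simp, fun n hn => ?_, fun D₁ D₂ hD₁ hD₂ _ => ⟨1, 1, fun n => ?_,
    fun n => ?_, fun n hn => ?_, fun n hn => ?_, fun n => by rw [mul_one]⟩⟩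
  · simp only [ArithmeticFunction.one_apply]; split_ifs <;> simp
  · simp only [ArithmeticFunction.one_apply]
    rw [if_neg]
    rintro rfl
    exact absurd (hD.trans_lt hn) (by norm_num)
  · rw [ArithmeticFunction.one_apply]; split_ifs <;> simp
  · rw [ArithmeticFunction.one_apply]; split_ifs <;> simp
  · rw [ArithmeticFunction.one_apply, if_neg]
    rintro rfl
    exact absurd (hD₁.trans_lt hn) (by norm_num)
  · rw [ArithmeticFunction.one_apply, if_neg]
    rintro rfl
    exact absurd (hD₂.trans_lt hn) (by norm_num)

/-- **Monotonicity of the level.** A well-factorable function of level `D ≥ 1` is well-factorable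
of every larger level `D' ≥ D`: given `D' = D₁' D₂'`, factor `D = D₁ D₂` with
`D₁ = min(D₁', D)`, `D₂ = D/D₁ ≤ D₂'` and reuse `λ = α ⋆ β` (implicit in BFI 1986 §1 and in
Maynard 2020, Theorem "BFI1": "well-factorable of level `Q ≤ x^{4/7−ε}`"). [folklore] -/
theorem IsWellFactorable.mono {D' : ℝ} (h : IsWellFactorable D lam) (hD : 1 ≤ D) (hDD' : D ≤ D') :
    IsWellFactorable D' lam := by
  refine ⟨h.1, h.2.1, fun n hn => h.2.2.1 n (lt_of_le_of_lt hDD' hn), fun D₁' D₂' h₁ h₂ hprod => ?_⟩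
  have hD₁pos : 0 < min D₁' D := lt_min (by linarith) (by linarith)
  have hD₁one : 1 ≤ min D₁' D := le_min h₁ hD
  have hD₂one : 1 ≤ D / min D₁' D := by
    rw [le_div_iff₀ hD₁pos, one_mul]
    exact min_le_right _ _
  have hprod' : min D₁' D * (D / min D₁' D) = D := mul_div_cancel₀ D hD₁pos.ne'
  obtain ⟨α, β, hα, hβ, hαs, hβs, hconv⟩ := h.2.2.2 _ _ hD₁one hD₂one hprod'
  refine ⟨α, β, hα, hβ, fun n hn => hαs n (lt_of_le_of_lt (min_le_left _ _) hn),
    fun n hn => hβs n (lt_of_le_of_lt ?_ hn), hconv⟩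
  -- `D / min D₁' D ≤ D₂'`
  rcases le_total D₁' D with hle | hle
  · rw [min_eq_left hle, div_le_iff₀ (by linarith), mul_comm, hprod]
    exact hDD'
  · rw [min_eq_right hle, div_self (by linarith)]
    exact h₂

/-- The sum over the moduli may be extended past the level: a well-factorable `λ` of level `Q`
vanishes on `q > Q`, so `∑_{q ≤ N} λ(q) f(q) = ∑_{q ≤ ⌊Q⌋} λ(q) f(q)` for `⌊Q⌋ ≤ N`. [folklore] -/
theorem IsWellFactorable.sum_Icc_eq_sum_Icc_floor (h : IsWellFactorable D lam) {N : ℕ}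
    (hN : ⌊D⌋₊ ≤ N) (p : ℕ → Prop) [DecidablePred p] (f : ℕ → ℝ) :
    ∑ q ∈ (Icc 1 N).filter p, lam q * f q = ∑ q ∈ (Icc 1 ⌊D⌋₊).filter p, lam q * f q := by
  symm
  refine Finset.sum_subset (Finset.filter_subset_filter _ (Finset.Icc_subset_Icc le_rfl hN)) ?_
  intro q hq hq'
  rw [Finset.mem_filter, Finset.mem_Icc] at hq hq'
  have hDq : D < q := by
    by_contra hle
    rw [not_lt] at hle
    rcases lt_or_ge D 0 with hD0 | hD0
    · exact absurd (hD0.trans_le (by positivity : (0 : ℝ) ≤ q)) (not_lt.mpr hle)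
    exact hq' ⟨⟨hq.1.1, Nat.le_floor hle⟩, hq.2⟩
  rw [h.eq_zero_of_lt hDq, zero_mul]

/-- A well-factorable function of level `D < 1` vanishes identically (it is supported on
`1 ≤ n ≤ D`). [folklore] -/
theorem IsWellFactorable.eq_zero_of_level_lt_one (h : IsWellFactorable D lam) (hD : D < 1) :
    lam = fun _ => 0 := by
  funext n
  rcases Nat.eq_zero_or_pos n with rfl | hn
  · exact h.apply_zero
  · exact h.eq_zero_of_lt (hD.trans_le (by exact_mod_cast hn))

end API

/-! ### API for the well-factorable level of distribution -/

/-- **Monotonicity of the well-factorable level of distribution.** If the primes have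
well-factorable level `x^θ`, they have well-factorable level `x^{θ'}` for every `θ' ≤ θ`: a family
`λ_x` well-factorable of level `x^{θ'−ε}` is well-factorable of level `x^{θ−ε}` for `x ≥ 1`
(`IsWellFactorable.mono`; when `x^{θ'−ε} < 1` the weight vanishes), and the sum over
`q ≤ x^{θ−ε}` reduces to the sum over `q ≤ x^{θ'−ε}`, `λ_x` being supported there. [folklore] -/
theorem PrimesHaveWellFactorableLevel.mono {θ θ' : ℝ} (h : PrimesHaveWellFactorableLevel θ)
    (hθ : θ' ≤ θ) : PrimesHaveWellFactorableLevel θ' := by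
  intro a ha A hA ε hε lam hlam
  classical
  -- the modified family (zero below `x = 1`) is well-factorable of level `x^{θ−ε}` for every `x`
  set lam' : ℝ → ℕ → ℝ := fun x => if 1 ≤ x then lam x else fun _ => 0 with hlam'_def
  have hlam' : ∀ x, IsWellFactorable (x ^ (θ - ε)) (lam' x) := by
    intro x
    by_cases hx : 1 ≤ x
    · simp only [hlam'_def, if_pos hx]
      rcases lt_or_ge (x ^ (θ' - ε)) 1 with hlt | hge
      · rw [(hlam x).eq_zero_of_level_lt_one hlt]
        exact isWellFactorable_zero _
      · exact (hlam x).mono hge (Real.rpow_le_rpow_of_exponent_le hx (by linarith))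
    · simp only [hlam'_def, if_neg hx]
      exact isWellFactorable_zero _
  refine (h a ha A hA ε hε lam' hlam').congr' ?_ EventuallyEq.rfl
  filter_upwards [eventually_ge_atTop (1 : ℝ)] with x hx
  have hlx : lam' x = lam x := by simp only [hlam'_def, if_pos hx]
  rw [hlx]
  have hN : ⌊x ^ (θ' - ε)⌋₊ ≤ ⌊x ^ (θ - ε)⌋₊ :=
    Nat.floor_le_floor (Real.rpow_le_rpow_of_exponent_le hx (by linarith))
  exact (hlam x).sum_Icc_eq_sum_Icc_floor hN _ _

/-- **A level of distribution is a well-factorable level of distribution.** If the primes have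
level `x^θ` in the Bombieri–Vinogradov sense (`PrimesHaveLevel θ`: maximum over the reduced
residues and over `y ≤ x`), then they have well-factorable level `x^θ`: for `|λ| ≤ 1` and
`(q, a) = 1`, `|λ(q)(ψ(x; q, a) − x/φ(q))| ≤ E*(x; q)`.  In particular Bombieri–Vinogradov
((1.4) of BFI 1986 §1) gives `PrimesHaveWellFactorableLevel θ` for all `θ < 1/2`, while BFI
Theorem 10 is the case `θ = 4/7` (for moduli beyond `x^{1/2}` "we must drop from both (1.5) and
(1.4) the expression `max_{(a,q)=1}`", BFI 1986 §1, remark following (1.6)). [folklore] -/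
theorem PrimesHaveLevel.primesHaveWellFactorableLevel {θ : ℝ} (h : PrimesHaveLevel θ) :
    PrimesHaveWellFactorableLevel θ := by
  intro a ha A hA ε hε lam hlam
  refine IsBigO.trans (IsBigO.of_bound 1 ?_) (h A hA ε hε)
  filter_upwards [eventually_ge_atTop (1 : ℝ)] with x hx
  rw [one_mul, Real.norm_eq_abs, Real.norm_eq_abs,
    abs_of_nonneg (Finset.sum_nonneg fun q _ => primeAPError_nonneg x q)]
  refine (Finset.abs_sum_le_sum_abs _ _).trans ?_
  refine (Finset.sum_le_sum_of_subset_of_nonneg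
    (Finset.filter_subset (fun q : ℕ => IsCoprime (q : ℤ) a) _) fun q _ _ =>
    primeAPError_nonneg x q).trans' ?_
  refine Finset.sum_le_sum fun q hq => ?_
  rw [Finset.mem_filter, Finset.mem_Icc] at hq
  have hq0 : q ≠ 0 := by omega
  obtain ⟨u, hu⟩ := (ZMod.coe_int_isUnit_iff_isCoprime a q).mpr hq.2
  rw [abs_mul]
  refine (mul_le_of_le_one_left (abs_nonneg _) ((hlam x).abs_le_one q)).trans ?_
  rw [← hu]
  exact abs_sub_le_primeAPError hq0 hx le_rfl u

/-- Bombieri–Vinogradov in the well-factorable form: `BombieriVinogradovStatement` gives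
`PrimesHaveWellFactorableLevel θ` for every `θ < 1/2`. [folklore] -/
theorem primesHaveWellFactorableLevel_of_bombieriVinogradov (h : BombieriVinogradovStatement)
    {θ : ℝ} (hθ : θ < 1 / 2) : PrimesHaveWellFactorableLevel θ :=
  (h θ hθ).primesHaveWellFactorableLevel

/-! ### BFI Theorem 10 as printed (the `ψ`-form) -/

/-- **Bombieri–Friedlander–Iwaniec 1986, Theorem 10** (as printed, Acta Math. 156 (1986), §1:
"Let `a ≠ 0`, `ε > 0` and `Q = x^{4/7−ε}`. For any well factorable function `λ(q)` of level `Q` and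
any `A > 0` we have `∑_{(q,a)=1} λ(q) (ψ(x; q, a) − x/φ(q)) ≪ x ℒ^{−A}`; the constant implied in `≪`
depends at most on `ε`, `a` and `A`" (`ℒ = log x`)).  Rendered: for `a ≠ 0`, `ε > 0`, `A > 0` there
are `C, x₀` such that for all `x ≥ x₀` and every `λ` with `IsWellFactorable (x^{4/7−ε}) λ`,
`|∑_{1 ≤ q ≤ x^{4/7−ε}, (q,a)=1} λ(q) (ψ(x; q, a) − x/φ(q))| ≤ C x/(log x)^A`, where
`ψ(x; q, a) = chebyshevPsiMod q a x` (the sum over all `(q, a) = 1` in the print is the sum over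
`q ≤ Q`, `λ` being supported in `[1, Q]`).  A deep THEOREM (Linnik's dispersion method,
Deshouillers–Iwaniec bounds for sums of Kloosterman sums, Heath-Brown's identity; proof in §17 of
the source from its Theorems 1, 2 and 5*); not in Mathlib.
[cite: BombieriFriedlanderIwaniecActa1986, §1 Theorem 10] -/
def BombieriFriedlanderIwaniecTheorem10 : Prop :=
  ∀ a : ℤ, a ≠ 0 → ∀ ε : ℝ, 0 < ε → ∀ A : ℝ, 0 < A →
    ∃ C x₀ : ℝ, ∀ x : ℝ, x₀ ≤ x →
      ∀ lam : ℕ → ℝ, IsWellFactorable (x ^ (4 / 7 - ε)) lam →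
        |∑ q ∈ (Icc 1 ⌊x ^ (4 / 7 - ε)⌋₊).filter (fun q : ℕ => IsCoprime (q : ℤ) a),
            lam q * (LevelOfDistribution.chebyshevPsiMod q (a : ZMod q) x - x / Nat.totient q)| ≤
          C * x / Real.log x ^ A

/-- Unfolding `BombieriFriedlanderIwaniecTheorem10` at given `a, ε, A`, with the constant
normalised to be nonnegative and the threshold to be `≥ 2` (cosmetic). [folklore] -/
theorem BombieriFriedlanderIwaniecTheorem10.bound_nonneg (h : BombieriFriedlanderIwaniecTheorem10)
    {a : ℤ} (ha : a ≠ 0) {ε : ℝ} (hε : 0 < ε) {A : ℝ} (hA : 0 < A) :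
    ∃ C x₀ : ℝ, 0 ≤ C ∧ 2 ≤ x₀ ∧ ∀ x : ℝ, x₀ ≤ x →
      ∀ lam : ℕ → ℝ, IsWellFactorable (x ^ (4 / 7 - ε)) lam →
        |∑ q ∈ (Icc 1 ⌊x ^ (4 / 7 - ε)⌋₊).filter (fun q : ℕ => IsCoprime (q : ℤ) a),
            lam q * (LevelOfDistribution.chebyshevPsiMod q (a : ZMod q) x - x / Nat.totient q)| ≤
          C * x / Real.log x ^ A := by
  obtain ⟨C, x₀, hC⟩ := h a ha ε hε A hA
  refine ⟨max C 0, max x₀ 2, le_max_right _ _, le_max_right _ _, fun x hx lam hlam => ?_⟩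
  have hx₀ : x₀ ≤ x := (le_max_left _ _).trans hx
  have hx2 : 2 ≤ x := (le_max_right _ _).trans hx
  refine (hC x hx₀ lam hlam).trans ?_
  have hlog : 0 < Real.log x := Real.log_pos (by linarith)
  gcongr
  exact le_max_left _ _

/-- **The printed theorem gives the tree's fact.** `BombieriFriedlanderIwaniecTheorem10` (uniform
in the well-factorable weight `λ`) implies `bfi_wellFactorable_level =
PrimesHaveWellFactorableLevel (4/7)`, which asks, for each family `λ_x` of well-factorable
functions of level `x^{4/7−ε}`, that the weighted sum be `=O[atTop] x/(log x)^A`: instantiate the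
uniform bound at `λ = λ_x` for `x ≥ x₀`. [cite: BombieriFriedlanderIwaniecActa1986, §1 Theorem 10] -/
theorem bfi_wellFactorable_level_of_theorem10 (h : BombieriFriedlanderIwaniecTheorem10) :
    bfi_wellFactorable_level := by
  intro a ha A hA ε hε lam hlam
  obtain ⟨C, x₀, hC0, hx₀2, hC⟩ := h.bound_nonneg ha hε hA
  refine IsBigO.of_bound C ?_
  filter_upwards [eventually_ge_atTop x₀] with x hx
  have hx2 : 2 ≤ x := hx₀2.trans hx
  have hlog : 0 < Real.log x := Real.log_pos (by linarith)
  have hrhs : 0 ≤ x / Real.log x ^ A := by positivity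
  rw [Real.norm_eq_abs, Real.norm_eq_abs, abs_of_nonneg hrhs, ← mul_div_assoc]
  exact hC x hx (lam x) (hlam x)

/-- `bfi_wellFactorable_level` (level `x^{4/7}`) gives every well-factorable level `θ ≤ 4/7`
(`PrimesHaveWellFactorableLevel.mono`). [folklore] -/
theorem bfi_wellFactorable_level.primesHaveWellFactorableLevel (h : bfi_wellFactorable_level)
    {θ : ℝ} (hθ : θ ≤ 4 / 7) : PrimesHaveWellFactorableLevel θ :=
  PrimesHaveWellFactorableLevel.mono h hθ

/-! ### BFI Theorem 10 in the `π`-form (Maynard's restatement) -/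

/-- **Bombieri–Friedlander–Iwaniec, Theorem 10, `π`-form** (as restated in Maynard,
arXiv:2006.07088 = Mem. AMS 2025, p. 3, "Theorem (Bombieri, Friedlander, Iwaniec) [BFI1]", and in
Lichtman, arXiv:2309.08522, (1.3)).  Let `a ≠ 0` be an integer and `A > 0`, `ε > 0`. There is a
constant `C = C(a, A, ε)` such that for all sufficiently large `x`, every `Q ≤ x^{4/7 − ε}` and every
function `λ` well-factorable of level `Q` (`IsWellFactorable Q λ`),
`|∑_{q ≤ Q, (q, a) = 1} λ(q) (π(x; q, a) − π(x)/φ(q))| ≤ C x / (log x)^A`,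
where `π(x; q, a) = #{p ≤ x : p ≡ a (mod q)}` (`primeCountingMod`) and `π(x) = #{p ≤ x}`.
Maynard allows `a ∈ ℤ`; we keep BFI's `a ≠ 0` (weaker).  NOTE: the theorem printed in BFI 1986 is
the `ψ`-form `BombieriFriedlanderIwaniecTheorem10` above; the two forms are equivalent by partial
summation and the prime number theorem with error `O(x/(log x)^{A+2})`, and the direction
`π`-form ⇒ `bfi_wellFactorable_level` is proved in
`Literature.NumberTheory.Sieve.BombieriFriedlanderIwaniecProofs`. A deep THEOREM; not in Mathlib.
[cite: Maynard2020LargeModuliII, p. 3, Theorem (Bombieri–Friedlander–Iwaniec)] -/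
def BombieriFriedlanderIwaniecTheorem10Pi : Prop :=
  ∀ a : ℤ, a ≠ 0 → ∀ A : ℝ, 0 < A → ∀ ε : ℝ, 0 < ε →
    ∃ C x₀ : ℝ, ∀ x : ℝ, x₀ ≤ x → ∀ Q : ℝ, Q ≤ x ^ (4 / 7 - ε) →
      ∀ lam : ℕ → ℝ, IsWellFactorable Q lam →
        |∑ q ∈ (Icc 1 ⌊Q⌋₊).filter (fun q : ℕ => IsCoprime (q : ℤ) a),
            lam q * ((LevelOfDistribution.primeCountingMod q (a : ZMod q).val ⌊x⌋₊ : ℝ) -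
              (Nat.primeCounting ⌊x⌋₊ : ℝ) / Nat.totient q)| ≤ C * x / Real.log x ^ A

/-- Unfolding `BombieriFriedlanderIwaniecTheorem10Pi` at given `a, A, ε` (definition). [folklore] -/
theorem BombieriFriedlanderIwaniecTheorem10Pi.bound (h : BombieriFriedlanderIwaniecTheorem10Pi)
    {a : ℤ} (ha : a ≠ 0) {A : ℝ} (hA : 0 < A) {ε : ℝ} (hε : 0 < ε) :
    ∃ C x₀ : ℝ, ∀ x : ℝ, x₀ ≤ x → ∀ Q : ℝ, Q ≤ x ^ (4 / 7 - ε) →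
      ∀ lam : ℕ → ℝ, IsWellFactorable Q lam →
        |∑ q ∈ (Icc 1 ⌊Q⌋₊).filter (fun q : ℕ => IsCoprime (q : ℤ) a),
            lam q * ((LevelOfDistribution.primeCountingMod q (a : ZMod q).val ⌊x⌋₊ : ℝ) -
              (Nat.primeCounting ⌊x⌋₊ : ℝ) / Nat.totient q)| ≤ C * x / Real.log x ^ A :=
  h a ha A hA ε hε

/-- The constant in `BombieriFriedlanderIwaniecTheorem10Pi` may be taken nonnegative and the
threshold `x₀ ≥ 2` (cosmetic normalisation used by the reduction to the `ψ`-form). [folklore] -/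
theorem BombieriFriedlanderIwaniecTheorem10Pi.bound_nonneg (h : BombieriFriedlanderIwaniecTheorem10Pi)
    {a : ℤ} (ha : a ≠ 0) {A : ℝ} (hA : 0 < A) {ε : ℝ} (hε : 0 < ε) :
    ∃ C x₀ : ℝ, 0 ≤ C ∧ 2 ≤ x₀ ∧ ∀ x : ℝ, x₀ ≤ x → ∀ Q : ℝ, Q ≤ x ^ (4 / 7 - ε) →
      ∀ lam : ℕ → ℝ, IsWellFactorable Q lam →
        |∑ q ∈ (Icc 1 ⌊Q⌋₊).filter (fun q : ℕ => IsCoprime (q : ℤ) a),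
            lam q * ((LevelOfDistribution.primeCountingMod q (a : ZMod q).val ⌊x⌋₊ : ℝ) -
              (Nat.primeCounting ⌊x⌋₊ : ℝ) / Nat.totient q)| ≤ C * x / Real.log x ^ A := by
  obtain ⟨C, x₀, hC⟩ := h a ha A hA ε hε
  refine ⟨max C 0, max x₀ 2, le_max_right _ _, le_max_right _ _, fun x hx Q hQ lam hlam => ?_⟩
  have hx₀ : x₀ ≤ x := (le_max_left _ _).trans hx
  have hx2 : 2 ≤ x := (le_max_right _ _).trans hx
  refine (hC x hx₀ Q hQ lam hlam).trans ?_
  have hlog : 0 < Real.log x := Real.log_pos (by linarith)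
  gcongr
  exact le_max_left _ _

end Literature.NumberTheory.Sieve
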